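import Literature.NumberTheory.LFunctions.SelbergDelangeTheorem
import Literature.NumberTheory.LFunctions.SatheSelbergEulerProduct
import Mathlib.Analysis.Analytic.Binomial
import HarnessLib

/-!
# The coefficients `d_z(n)` of `ζ(s)^z`: multiplicativity, majorant, Euler product

Support file (PROVED theorems only, no definitions, no named facts) for the proof of
Montgomery–Vaughan, *Multiplicative Number Theory I*, Theorem 7.17
(`Literature.NumberTheory.LFunctions.MontgomeryVaughan2007_thm_7_17`,
`SelbergDelangeTheorem.lean`), following §7.4, (7.56):
"`ζ(s)^z = ∏_p (1 − p^{−s})^{−z} = ∑_{n=1}^∞ d_z(n) n^{−s}` (`σ > 1`)".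

For the tree's `zetaPowCoeff z n = d_z(n)` (defined through `Nat.factorization`, with
`d_z(p^k) = z(z+1)⋯(z+k−1)/k!`) we prove:

* `zetaPowCoeff_mul_of_coprime`, `zetaPowCoeff_prime_pow` — multiplicativity and the values at
  prime powers;
* `norm_zetaPowCoeff_le` — the majorant "`|d_z(n)| ≤ d_{|z|}(n) ≤ d_R(n)`" (MV p. 178) in the form
  `‖d_z(n)‖ ≤ ‖d_R(n)‖` for `‖z‖ ≤ R`, where `d_R(n)` (`R ≥ 0` real) is a non-negative real
  (`zetaPowCoeff_ofReal_eq_norm`);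
* `hasSum_zetaPowCoeff_prime_pow_mul_pow` — the local factor: the binomial series
  `∑_k d_z(p^k) q^k = exp(−z Log(1 − q))` for `‖q‖ < 1` (Mathlib's
  `Complex.one_div_one_sub_cpow_hasFPowerSeriesOnBall_zero`);
* `summable_norm_term_zetaPowCoeff`, `LSeries_zetaPowCoeff_eq_exp` — absolute convergence of
  `∑ d_z(n) n^{−s}` for `σ > 1` and **(7.56)**: `∑ d_z(n) n^{−s} = exp(z ∑_p −Log(1 − p^{−s}))`
  `= exp(z · eulerLogZeta s)` (the tree's Euler logarithm of `ζ`, `LogZetaClassicalRegion.lean`),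
  along the lines of the tree's treatment of `∑ z^{ω(n)} n^{−s}` (`SatheSelbergEulerProduct.lean`,
  whose generic lemmas `term_mul_of_coprime`, `hasSum_eulerLogZeta` are reused).

## References

* [MontgomeryVaughan2007] H. L. Montgomery, R. C. Vaughan, *Multiplicative Number Theory I*,
  CUP 2007, §7.4 (7.56) and p. 178.
-/

noncomputable section

open Complex Finset Filter Topology LSeries

namespace Literature.NumberTheory.LFunctions

namespace SelbergDelange

/-! ### The local coefficients `z(z+1)⋯(z+k−1)/k!` -/

/-- The local coefficient at `k = 0` is `1`. [folklore] -/
theorem localCoeff_zero (z : ℂ) :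
    (∏ j ∈ Finset.range 0, (z + (j : ℂ))) / ((0 : ℕ).factorial : ℂ) = 1 := by
  simp

/-- The local coefficient at `k = 1` is `z` (`d_z(p) = z`). [folklore] -/
theorem localCoeff_one (z : ℂ) :
    (∏ j ∈ Finset.range 1, (z + (j : ℂ))) / ((1 : ℕ).factorial : ℂ) = z := by
  simp

/-- Norm of the local coefficient: `‖z(z+1)⋯(z+k−1)/k!‖ ≤ R(R+1)⋯(R+k−1)/k!` for `‖z‖ ≤ R`.
[cite: MontgomeryVaughan2007, §7.4 p. 178 (|d_z(n)| ≤ d_{|z|}(n) ≤ d_R(n))] -/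
theorem norm_localCoeff_le {z : ℂ} {R : ℝ} (hz : ‖z‖ ≤ R) (k : ℕ) :
    ‖(∏ j ∈ Finset.range k, (z + (j : ℂ))) / (k.factorial : ℂ)‖ ≤
      (∏ j ∈ Finset.range k, (R + (j : ℝ))) / (k.factorial : ℝ) := by
  rw [norm_div, Complex.norm_natCast, norm_prod]
  refine div_le_div_of_nonneg_right ?_ (by positivity)
  refine Finset.prod_le_prod (fun j _ ↦ norm_nonneg _) fun j _ ↦ ?_
  calc ‖z + (j : ℂ)‖ ≤ ‖z‖ + ‖(j : ℂ)‖ := norm_add_le _ _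
    _ = ‖z‖ + j := by rw [Complex.norm_natCast]
    _ ≤ R + j := by linarith

/-- The local coefficient at a real parameter is the cast of the real product. [folklore] -/
theorem localCoeff_ofReal (R : ℝ) (k : ℕ) :
    (∏ j ∈ Finset.range k, ((R : ℂ) + (j : ℂ))) / (k.factorial : ℂ) =
      (((∏ j ∈ Finset.range k, (R + (j : ℝ))) / (k.factorial : ℝ) : ℝ) : ℂ) := by
  push_cast
  rfl

/-- For `R ≥ 0` the real local coefficient is non-negative. [folklore] -/
theorem localCoeff_real_nonneg {R : ℝ} (hR : 0 ≤ R) (k : ℕ) :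
    0 ≤ (∏ j ∈ Finset.range k, (R + (j : ℝ))) / (k.factorial : ℝ) :=
  div_nonneg (Finset.prod_nonneg fun j _ ↦ by positivity) (by positivity)

/-- The local coefficient is Mathlib's generalized binomial coefficient
`Ring.choose (z + k − 1) k` (the coefficient of the binomial series of `(1 − q)^{−z}`).
[folklore] -/
theorem localCoeff_eq_choose (z : ℂ) (k : ℕ) :
    (∏ j ∈ Finset.range k, (z + (j : ℂ))) / (k.factorial : ℂ) = Ring.choose (z + k - 1) k := by
  rw [← Ring.multichoose_eq]
  have h1 : (k.factorial : ℂ) * Ring.multichoose z k = (ascPochhammer ℂ k).eval z := by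
    rw [← nsmul_eq_mul, Ring.factorial_nsmul_multichoose_eq_ascPochhammer,
      Polynomial.ascPochhammer_smeval_eq_eval]
  have h2 : ∀ n : ℕ, (ascPochhammer ℂ n).eval z = ∏ j ∈ Finset.range n, (z + (j : ℂ)) := by
    intro n
    induction n with
    | zero => simp
    | succ n ih => rw [ascPochhammer_succ_eval, ih, Finset.prod_range_succ]
  rw [← h2, ← h1, mul_div_cancel_left₀ _ (by exact_mod_cast k.factorial_ne_zero)]

/-! ### Multiplicativity and prime powers -/

/-- `d_z(p^k) = z(z+1)⋯(z+k−1)/k!`. [cite: MontgomeryVaughan2007, §7.4 (7.56)] -/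
theorem zetaPowCoeff_prime_pow (z : ℂ) {p : ℕ} (hp : p.Prime) (k : ℕ) :
    zetaPowCoeff z (p ^ k) = (∏ j ∈ Finset.range k, (z + (j : ℂ))) / (k.factorial : ℂ) := by
  rw [zetaPowCoeff, if_neg (pow_ne_zero k hp.ne_zero), Nat.Prime.factorization_pow hp,
    Finsupp.prod_single_index (localCoeff_zero z)]

/-- `d_z(p) = z`. [cite: MontgomeryVaughan2007, §7.4 p. 177 (d_z(p) = z)] -/
theorem zetaPowCoeff_prime (z : ℂ) {p : ℕ} (hp : p.Prime) : zetaPowCoeff z p = z := by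
  simpa using zetaPowCoeff_prime_pow z hp 1

/-- `d_z` is multiplicative. [cite: MontgomeryVaughan2007, §7.4 (7.56)] -/
theorem zetaPowCoeff_mul_of_coprime (z : ℂ) {m n : ℕ} (h : m.Coprime n) :
    zetaPowCoeff z (m * n) = zetaPowCoeff z m * zetaPowCoeff z n := by
  rcases eq_or_ne m 0 with rfl | hm
  · simp [zetaPowCoeff]
  rcases eq_or_ne n 0 with rfl | hn
  · simp [zetaPowCoeff]
  rw [zetaPowCoeff, if_neg (mul_ne_zero hm hn), zetaPowCoeff, if_neg hm, zetaPowCoeff, if_neg hn,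
    Nat.factorization_mul_of_coprime h, Finsupp.prod_add_index_of_disjoint]
  exact h.disjoint_primeFactors

/-! ### The real majorant `d_R`, `R ≥ 0` -/

/-- For real `R`, `d_R(n)` is the cast of a real number: the factorization product of the real
local coefficients. [folklore] -/
theorem zetaPowCoeff_ofReal (R : ℝ) (n : ℕ) :
    zetaPowCoeff (R : ℂ) n = ((if n = 0 then (0 : ℝ) else
      n.factorization.prod fun _ k ↦ (∏ j ∈ Finset.range k, (R + (j : ℝ))) / (k.factorial : ℝ) : ℝ) : ℂ) := by
  unfold zetaPowCoeff
  split_ifs with h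
  · simp
  · rw [Finsupp.prod, Finsupp.prod, Complex.ofReal_prod]
    exact Finset.prod_congr rfl fun p _ ↦ localCoeff_ofReal R _

/-- For real `R ≥ 0`, `d_R(n)` is a non-negative real: `d_R(n) = ‖d_R(n)‖`. [folklore] -/
theorem zetaPowCoeff_ofReal_eq_norm {R : ℝ} (hR : 0 ≤ R) (n : ℕ) :
    zetaPowCoeff (R : ℂ) n = ((‖zetaPowCoeff (R : ℂ) n‖ : ℝ) : ℂ) := by
  rw [zetaPowCoeff_ofReal]
  congr 1
  rw [Complex.norm_real, Real.norm_eq_abs, eq_comm, abs_eq_self]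
  split_ifs with h
  · exact le_rfl
  · exact Finset.prod_nonneg fun p _ ↦ localCoeff_real_nonneg hR _

/-- `(d_R(n)).re = ‖d_R(n)‖` and `(d_R(n)).im = 0` for `R ≥ 0`. [folklore] -/
theorem zetaPowCoeff_ofReal_re {R : ℝ} (hR : 0 ≤ R) (n : ℕ) :
    (zetaPowCoeff (R : ℂ) n).re = ‖zetaPowCoeff (R : ℂ) n‖ := by
  rw [zetaPowCoeff_ofReal_eq_norm hR n, Complex.ofReal_re, Complex.norm_real, Real.norm_eq_abs,
    abs_norm]

/-- **The majorant** `‖d_z(n)‖ ≤ d_R(n)` for `‖z‖ ≤ R` (termwise on the factorization).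
[cite: MontgomeryVaughan2007, §7.4 p. 178] -/
theorem norm_zetaPowCoeff_le {z : ℂ} {R : ℝ} (hz : ‖z‖ ≤ R) (n : ℕ) :
    ‖zetaPowCoeff z n‖ ≤ ‖zetaPowCoeff (R : ℂ) n‖ := by
  have hR : 0 ≤ R := (norm_nonneg z).trans hz
  rcases eq_or_ne n 0 with rfl | hn
  · simp [zetaPowCoeff]
  rw [zetaPowCoeff_ofReal, if_neg hn, Complex.norm_real, Real.norm_eq_abs, Finsupp.prod,
    abs_of_nonneg (Finset.prod_nonneg fun p _ ↦ localCoeff_real_nonneg hR _), zetaPowCoeff,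
    if_neg hn, Finsupp.prod, norm_prod]
  exact Finset.prod_le_prod (fun p _ ↦ norm_nonneg _) fun p _ ↦ norm_localCoeff_le hz _

/-- Monotonicity of the majorant in `R`: `d_r(n) ≤ d_R(n)` for `0 ≤ r ≤ R`. [folklore] -/
theorem norm_zetaPowCoeff_ofReal_mono {r R : ℝ} (hr : 0 ≤ r) (hrR : r ≤ R) (n : ℕ) :
    ‖zetaPowCoeff (r : ℂ) n‖ ≤ ‖zetaPowCoeff (R : ℂ) n‖ :=
  norm_zetaPowCoeff_le (by rwa [Complex.norm_real, Real.norm_eq_abs, abs_of_nonneg hr]) n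

/-! ### The local factor: the binomial series -/

/-- **The local factor of `ζ(s)^z`**: for `‖q‖ < 1`,
`∑_k z(z+1)⋯(z+k−1)/k! · q^k = exp(−z Log(1 − q)) = (1 − q)^{−z}` (binomial series).
[cite: MontgomeryVaughan2007, §7.4 (7.56)] -/
theorem hasSum_localCoeff_mul_pow (z : ℂ) {q : ℂ} (hq : ‖q‖ < 1) :
    HasSum (fun k : ℕ ↦ (∏ j ∈ Finset.range k, (z + (j : ℂ))) / (k.factorial : ℂ) * q ^ k)
      (exp (-(z * log (1 - q)))) := by
  have hp := Complex.one_div_one_sub_cpow_hasFPowerSeriesOnBall_zero z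
  have hmem : q ∈ Metric.eball (0 : ℂ) 1 := by
    rw [Metric.mem_eball, edist_zero_right, ← ofReal_norm]
    exact ENNReal.ofReal_lt_one.mpr hq
  have h := hp.hasSum hmem
  simp only [FormalMultilinearSeries.ofScalars_apply_eq, smul_eq_mul, zero_add] at h
  have h1q : 1 - q ≠ 0 := by
    intro h0
    have : ‖q‖ = 1 := by rw [← sub_eq_zero.1 h0]; simp
    linarith
  have hval : 1 / (1 - q) ^ z = exp (-(z * log (1 - q))) := by
    rw [cpow_def_of_ne_zero h1q, one_div, ← exp_neg, mul_comm]
  rw [hval] at h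
  exact h.congr_fun fun k ↦ by rw [localCoeff_eq_choose]

/-- The local factor at a prime power, in terms of `d_z`: for `‖q‖ < 1`,
`∑_k d_z(p^k) q^k = exp(−z Log(1 − q))`. [cite: MontgomeryVaughan2007, §7.4 (7.56)] -/
theorem hasSum_zetaPowCoeff_prime_pow_mul_pow (z : ℂ) {p : ℕ} (hp : p.Prime) {q : ℂ}
    (hq : ‖q‖ < 1) :
    HasSum (fun k : ℕ ↦ zetaPowCoeff z (p ^ k) * q ^ k) (exp (-(z * log (1 - q)))) := by
  simpa only [zetaPowCoeff_prime_pow z hp] using hasSum_localCoeff_mul_pow z hq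

/-! ### The Dirichlet series: absolute convergence for `σ > 1` -/

/-- The terms at prime powers: `d_z(p^e) (p^e)^{-s} = d_z(p^e) (p^{-s})^e`. [folklore] -/
theorem term_zetaPowCoeff_prime_pow (z s : ℂ) {p : ℕ} (hp : p.Prime) (e : ℕ) :
    term (zetaPowCoeff z) s (p ^ e) = zetaPowCoeff z (p ^ e) * ((p : ℂ) ^ (-s)) ^ e := by
  have hpe : p ^ e ≠ 0 := pow_ne_zero _ hp.ne_zero
  rw [term_of_ne_zero hpe, Nat.cast_pow, ← cpow_nat_mul, ← natCast_cpow_natCast_mul,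
    div_eq_mul_inv, ← cpow_neg, mul_neg]

/-- For a prime `p` and `σ ≥ 1`: `p^{-σ} ≤ 1/2`. [folklore] -/
theorem prime_rpow_neg_le_half {p : ℕ} (hp : p.Prime) {σ : ℝ} (hσ : 1 ≤ σ) :
    (p : ℝ) ^ (-σ) ≤ 1 / 2 := by
  have h2 : (2 : ℝ) ≤ p := by exact_mod_cast hp.two_le
  calc (p : ℝ) ^ (-σ) ≤ (2 : ℝ) ^ (-σ) := Real.rpow_le_rpow_of_nonpos (by norm_num) h2 (by linarith)
    _ ≤ (2 : ℝ) ^ (-1 : ℝ) := Real.rpow_le_rpow_of_exponent_le (by norm_num) (by linarith)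
    _ = 1 / 2 := by norm_num

/-- The real local factor of the majorant: for `0 ≤ q < 1` real and `R` real,
`∑_k d_R(p^k) q^k = (1 − q)^{−R} = exp(−R log(1 − q))` as a real series.
[cite: MontgomeryVaughan2007, §7.4 (7.56)] -/
theorem hasSum_norm_zetaPowCoeff_prime_pow_mul_pow {R : ℝ} (hR : 0 ≤ R) {p : ℕ} (hp : p.Prime)
    {q : ℝ} (hq0 : 0 ≤ q) (hq1 : q < 1) :
    HasSum (fun k : ℕ ↦ ‖zetaPowCoeff (R : ℂ) (p ^ k)‖ * q ^ k)
      (Real.exp (-(R * Real.log (1 - q)))) := by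
  have hqC : ‖(q : ℂ)‖ < 1 := by
    rw [Complex.norm_real, Real.norm_eq_abs, abs_of_nonneg hq0]; exact hq1
  have h := hasSum_zetaPowCoeff_prime_pow_mul_pow (R : ℂ) hp hqC
  have hlog : log (1 - (q : ℂ)) = ((Real.log (1 - q) : ℝ) : ℂ) := by
    rw [← ofReal_one, ← ofReal_sub, ofReal_log (by linarith)]
  rw [hlog, ← ofReal_mul, ← ofReal_neg, ← ofReal_exp] at h
  have hterm : (fun k : ℕ ↦ zetaPowCoeff (R : ℂ) (p ^ k) * (q : ℂ) ^ k) =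
      fun k : ℕ ↦ (((‖zetaPowCoeff (R : ℂ) (p ^ k)‖ * q ^ k : ℝ)) : ℂ) := by
    funext k
    conv_lhs => rw [zetaPowCoeff_ofReal_eq_norm hR]
    push_cast
    ring
  rw [hterm] at h
  exact Complex.hasSum_ofReal.1 h

/-- Bound for the real local factor: for `0 ≤ q ≤ 1/2`, `exp(−R log(1 − q)) ≤ exp(2Rq)`
(`−log(1 − q) ≤ q/(1 − q) ≤ 2q`). [folklore] -/
theorem exp_neg_mul_log_one_sub_le {R q : ℝ} (hR : 0 ≤ R) (hq0 : 0 ≤ q) (hq : q ≤ 1 / 2) :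
    Real.exp (-(R * Real.log (1 - q))) ≤ Real.exp (2 * R * q) := by
  rw [Real.exp_le_exp]
  have h1 : 0 < 1 - q := by linarith
  have hlog : -Real.log (1 - q) ≤ 2 * q := by
    have := Real.log_le_sub_one_of_pos (inv_pos.2 h1)
    rw [Real.log_inv] at this
    have h2 : (1 - q)⁻¹ - 1 = q / (1 - q) := by field_simp; ring
    rw [h2] at this
    have h3 : q / (1 - q) ≤ 2 * q := by
      rw [div_le_iff₀ h1]; nlinarith
    linarith
  nlinarith

/-- **Absolute convergence of `∑ d_z(n) n^{-s}` for `σ > 1`** (partial sums of the non-negative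
multiplicative majorant `d_R(n) n^{-σ}` are bounded by the finite Euler products
`∏_{p<N} (1 − p^{−σ})^{−R} ≤ exp(2R ∑_p p^{−σ})`). [cite: MontgomeryVaughan2007, §7.4 (7.56)] -/
theorem summable_norm_term_zetaPowCoeff (z : ℂ) {s : ℂ} (hs : 1 < s.re) :
    Summable fun n ↦ ‖term (zetaPowCoeff z) s n‖ := by
  set R : ℝ := ‖z‖ with hRdef
  have hR : 0 ≤ R := norm_nonneg z
  -- the majorant `F(n) = d_R(n) n^{-σ}` (norm of the terms at the real parameter `R`)
  set F : ℕ → ℝ := fun n ↦ ‖term (zetaPowCoeff (R : ℂ)) s n‖ with hF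
  have hσ : 0 < s.re := by linarith
  have hF1 : F 1 = 1 := by simp [hF, zetaPowCoeff_one]
  have hFmul : ∀ {m n : ℕ}, m.Coprime n → F (m * n) = F m * F n := by
    intro m n hmn
    simp only [hF,
      SatheSelberg.term_mul_of_coprime (fun h ↦ zetaPowCoeff_mul_of_coprime (R : ℂ) h) s hmn,
      norm_mul]
  have hF0 : ∀ n, 0 ≤ F n := fun n ↦ norm_nonneg _
  -- the local factors of the majorant
  have hFloc : ∀ {p : ℕ}, p.Prime → HasSum (fun e : ℕ ↦ F (p ^ e))
      (Real.exp (-(R * Real.log (1 - (p : ℝ) ^ (-s.re))))) := by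
    intro p hp
    have hq0 : 0 ≤ (p : ℝ) ^ (-s.re) := Real.rpow_nonneg (Nat.cast_nonneg _) _
    have hq1 : (p : ℝ) ^ (-s.re) < 1 := SatheSelberg.prime_rpow_neg_lt_one hp hσ
    have h := hasSum_norm_zetaPowCoeff_prime_pow_mul_pow hR hp hq0 hq1
    refine h.congr_fun fun e ↦ ?_
    simp only [hF]
    rw [term_zetaPowCoeff_prime_pow _ _ hp, norm_mul, norm_pow, norm_natCast_cpow_of_pos hp.pos,
      neg_re]
  have hFsum : ∀ {p : ℕ}, p.Prime → Summable (fun e : ℕ ↦ ‖F (p ^ e)‖) := by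
    intro p hp
    simp only [Real.norm_eq_abs, fun e ↦ abs_of_nonneg (hF0 (p ^ e))]
    exact (hFloc hp).summable
  -- the prime sum `S = ∑_p p^{-σ}`
  have hS : Summable fun p : Nat.Primes ↦ ((p : ℕ) : ℝ) ^ (-s.re) :=
    Nat.Primes.summable_rpow.2 (by linarith)
  set S : ℝ := ∑' p : Nat.Primes, ((p : ℕ) : ℝ) ^ (-s.re) with hSdef
  have hS0 : ∀ p : Nat.Primes, 0 ≤ ((p : ℕ) : ℝ) ^ (-s.re) := fun p ↦
    Real.rpow_nonneg (Nat.cast_nonneg _) _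
  have hloc : ∀ {p : ℕ}, p.Prime →
      ∑' e : ℕ, F (p ^ e) ≤ Real.exp (2 * R * (p : ℝ) ^ (-s.re)) := by
    intro p hp
    rw [(hFloc hp).tsum_eq]
    exact exp_neg_mul_log_one_sub_le hR (Real.rpow_nonneg (Nat.cast_nonneg _) _)
      (prime_rpow_neg_le_half hp hs.le)
  -- bounded partial sums of the majorant
  have hmaj : Summable F := by
    refine summable_of_sum_range_le hF0 (c := Real.exp (2 * R * S)) fun N ↦ ?_
    obtain ⟨-, hhas⟩ :=
      EulerProduct.summable_and_hasSum_smoothNumbers_prod_primesBelow_tsum hF1 hFmul hFsum N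
    have h1 : ∑ n ∈ range N, F n = ∑ n ∈ Ico 1 N, F n := by
      rcases Nat.eq_zero_or_pos N with rfl | hN
      · simp
      · rw [Finset.range_eq_Ico, ← Finset.sum_Ico_consecutive _ (Nat.zero_le 1) hN]
        simp [hF]
    have h2 : ∑ n ∈ Ico 1 N, F n = ∑ m ∈ (Ico 1 N).subtype (· ∈ N.smoothNumbers), F (m : ℕ) := by
      rw [Finset.sum_subtype_eq_sum_filter]
      refine Finset.sum_congr ?_ fun _ _ ↦ rfl
      refine (Finset.filter_true_of_mem fun d hd ↦ ?_).symm
      rw [Finset.mem_Ico] at hd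
      exact Nat.mem_smoothNumbers_of_lt hd.1 hd.2
    have h3 : ∑ m ∈ (Ico 1 N).subtype (· ∈ N.smoothNumbers), F (m : ℕ) ≤
        ∏ p ∈ N.primesBelow, ∑' e : ℕ, F (p ^ e) :=
      sum_le_hasSum _ (fun m _ ↦ hF0 _) hhas
    have h4 : ∏ p ∈ N.primesBelow, ∑' e : ℕ, F (p ^ e) ≤
        ∏ p ∈ N.primesBelow, Real.exp (2 * R * (p : ℝ) ^ (-s.re)) := by
      refine Finset.prod_le_prod (fun p _ ↦ tsum_nonneg fun e ↦ hF0 _) fun p hp ↦ ?_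
      exact hloc (Nat.prime_of_mem_primesBelow hp)
    have h5 : ∏ p ∈ N.primesBelow, Real.exp (2 * R * (p : ℝ) ^ (-s.re)) =
        Real.exp (2 * R * ∑ p ∈ N.primesBelow, (p : ℝ) ^ (-s.re)) := by
      rw [Finset.mul_sum, Real.exp_sum]
    have h6 : ∑ p ∈ N.primesBelow, (p : ℝ) ^ (-s.re) ≤ S := by
      have hprime : ∀ p ∈ N.primesBelow, Nat.Prime p := fun p hp ↦ Nat.prime_of_mem_primesBelow hp
      have e : ∑ p ∈ N.primesBelow, (p : ℝ) ^ (-s.re) =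
          ∑ p ∈ (N.primesBelow).subtype Nat.Prime, ((p : ℕ) : ℝ) ^ (-s.re) := by
        conv_lhs => rw [← Finset.filter_true_of_mem hprime, ← Finset.subtype_map,
          Finset.sum_map]
        rfl
      rw [e]
      exact sum_le_hasSum (f := fun p : Nat.Primes ↦ ((p : ℕ) : ℝ) ^ (-s.re)) _
        (fun p _ ↦ hS0 p) hS.hasSum
    calc ∑ n ∈ range N, F n = ∑ n ∈ Ico 1 N, F n := h1
      _ ≤ ∏ p ∈ N.primesBelow, ∑' e : ℕ, F (p ^ e) := h2 ▸ h3
      _ ≤ Real.exp (2 * R * ∑ p ∈ N.primesBelow, (p : ℝ) ^ (-s.re)) := h5 ▸ h4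
      _ ≤ Real.exp (2 * R * S) := by gcongr
  -- comparison `‖d_z(n) n^{-s}‖ ≤ F(n)`
  refine Summable.of_nonneg_of_le (fun n ↦ norm_nonneg _) (fun n ↦ ?_) hmaj
  rcases eq_or_ne n 0 with rfl | hn
  · simp [hF]
  simp only [hF, term_of_ne_zero hn, norm_div]
  exact div_le_div_of_nonneg_right (norm_zetaPowCoeff_le le_rfl n) (norm_nonneg _)

/-- `LSeriesSummable` form. [folklore] -/
theorem LSeriesSummable_zetaPowCoeff (z : ℂ) {s : ℂ} (hs : 1 < s.re) :
    LSeriesSummable (zetaPowCoeff z) s :=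
  (summable_norm_term_zetaPowCoeff z hs).of_norm

/-- Summability in the form used by Perron's formula: `∑ ‖d_z(n)‖ n^{−c} < ∞` for `c > 1`.
[folklore] -/
theorem summable_norm_zetaPowCoeff_div_rpow (z : ℂ) {c : ℝ} (hc : 1 < c) :
    Summable fun n : ℕ ↦ ‖zetaPowCoeff z n‖ / (n : ℝ) ^ c := by
  have h := summable_norm_term_zetaPowCoeff z (s := (c : ℂ)) (by simpa using hc)
  refine h.congr fun n ↦ ?_
  rcases eq_or_ne n 0 with rfl | hn
  · simp [zetaPowCoeff_zero, Real.zero_rpow (by linarith : c ≠ 0)]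
  rw [term_of_ne_zero hn, norm_div, norm_natCast_cpow_of_pos (Nat.pos_of_ne_zero hn), ofReal_re]

/-! ### The Euler product (7.56) -/

/-- The local factor of `∑ d_z(n) n^{-s}` at a prime: `∑_e d_z(p^e) p^{-es} = exp(−z Log(1 − p^{−s}))`
(`σ > 0`). [cite: MontgomeryVaughan2007, §7.4 (7.56)] -/
theorem hasSum_term_zetaPowCoeff_prime_pow (z : ℂ) {s : ℂ} (hs : 0 < s.re) (p : Nat.Primes) :
    HasSum (fun e : ℕ ↦ term (zetaPowCoeff z) s ((p : ℕ) ^ e))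
      (exp (-(z * log (1 - (p : ℂ) ^ (-s))))) := by
  have hqn : ‖(p : ℂ) ^ (-s)‖ < 1 := by
    rw [norm_natCast_cpow_of_pos p.prop.pos, neg_re]
    exact SatheSelberg.prime_rpow_neg_lt_one p.prop hs
  have h := hasSum_zetaPowCoeff_prime_pow_mul_pow z p.prop hqn
  refine h.congr_fun fun e ↦ ?_
  rw [term_zetaPowCoeff_prime_pow z s p.prop]

/-- **The Euler product (7.56)**, `HasProd` form: `∏_p exp(−z Log(1 − p^{−s})) = ∑ d_z(n) n^{−s}`
for `σ > 1`. [cite: MontgomeryVaughan2007, §7.4 (7.56)] -/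
theorem hasProd_LSeries_zetaPowCoeff (z : ℂ) {s : ℂ} (hs : 1 < s.re) :
    HasProd (fun p : Nat.Primes ↦ exp (-(z * log (1 - (p : ℂ) ^ (-s)))))
      (LSeries (zetaPowCoeff z) s) := by
  have hsum := summable_norm_term_zetaPowCoeff z hs
  have h1 : term (zetaPowCoeff z) s 1 = 1 := by
    rw [term_of_ne_zero one_ne_zero, zetaPowCoeff_one, Nat.cast_one, one_cpow, div_one]
  have hmul : ∀ {m n : ℕ}, m.Coprime n →
      term (zetaPowCoeff z) s (m * n) = term (zetaPowCoeff z) s m * term (zetaPowCoeff z) s n :=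
    fun h ↦ SatheSelberg.term_mul_of_coprime (fun h' ↦ zetaPowCoeff_mul_of_coprime z h') s h
  have hE := EulerProduct.eulerProduct_hasProd h1 hmul hsum (term_zero _ _)
  have heq : (fun p : Nat.Primes ↦ ∑' e : ℕ, term (zetaPowCoeff z) s ((p : ℕ) ^ e)) =
      fun p : Nat.Primes ↦ exp (-(z * log (1 - (p : ℂ) ^ (-s)))) :=
    funext fun p ↦ (hasSum_term_zetaPowCoeff_prime_pow z (by linarith) p).tsum_eq
  rw [heq] at hE
  exact hE

/-- **(7.56): `∑ d_z(n) n^{-s} = ζ(s)^z = exp(z ∑_p −Log(1 − p^{−s}))` for `σ > 1`**, with the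
tree's Euler logarithm `eulerLogZeta` (`exp ∘ eulerLogZeta = ζ` on `σ > 1`,
`LogZetaClassicalRegion.exp_eulerLogZeta`). [cite: MontgomeryVaughan2007, §7.4 (7.56)] -/
theorem LSeries_zetaPowCoeff_eq_exp (z : ℂ) {s : ℂ} (hs : 1 < s.re) :
    LSeries (zetaPowCoeff z) s = exp (z * eulerLogZeta s) := by
  have hL : HasProd (fun p : Nat.Primes ↦ exp (z * -log (1 - (p : ℂ) ^ (-s))))
      (exp (z * eulerLogZeta s)) := ((SatheSelberg.hasSum_eulerLogZeta hs).mul_left z).cexp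
  have heq : (fun p : Nat.Primes ↦ exp (z * -log (1 - (p : ℂ) ^ (-s)))) =
      fun p : Nat.Primes ↦ exp (-(z * log (1 - (p : ℂ) ^ (-s)))) := by
    funext p; rw [mul_neg]
  rw [heq] at hL
  exact (hasProd_LSeries_zetaPowCoeff z hs).unique hL

end SelbergDelange

end Literature.NumberTheory.LFunctions
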